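import Literature.RingTheory.MvPolynomial.FischerPairing
import Literature.Analysis.SpecialFunctions.GegenbauerConnection
import HarnessLib

/-!
# Positive-definiteness of the zonal Gegenbauer kernels on `ℝⁿ` (`μ = (n-2)/2`)

For `n ≥ 3`, `μ = (n-2)/2`, and every degree `j`, the kernel
`(x, x') ↦ ‖x‖^j ‖x'‖^j C^μ_j(⟨x, x'⟩/(‖x‖‖x'‖)) = P^μ_j(2⟨x, x'⟩, ‖x‖²‖x'‖²)` on `ℝⁿ` is
positive semidefinite (`sum_mul_gegenbauerHom_nonneg`). Classically this is the addition
theorem: the kernel is a positive multiple of the reproducing kernel `Σ_m Y_m(x) Y_m(x')` of the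
spherical harmonics of degree `j` (Andrews–Askey–Roy Thm. 9.6.3; Stein–Weiss IV.2). We give the
short algebraic proof through the **Fischer pairing** `B` of
`Literature.RingTheory.MvPolynomial.FischerPairing`:

* the zonal polynomial `h_x(y) = P^μ_j(2 L_x(y), |x|² Q(y)) ∈ ℝ[y]` (`gegenbauerHom μ j (C 2 *
  innerForm x) (C |x|² * sqNormPoly n)`); `laplacian_gegenbauerHom_zonal`: it is
  **harmonic** when `n = 2μ + 2` (explicit `Δ(Q^i L^m)` and a two-term cancellation along the
  antidiagonal — the classical `Δ_y (1 - 2⟨x,y⟩ + |x|²|y|²)^{-μ} = 0`);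
* `fischer_gegenbauerHom_zonal`: the **Gram identity**
  `B(h_x, h_{x'}) = a_j 2^j j! · P^μ_j(2⟨x,x'⟩, |x|²|x'|²)` (adjointness `B(Qf, g) = B(f, Δg)`
  kills every `Q`-multiple against the harmonic `h_{x'}`, and `B(L_x^m, L_{x'}^m) = m!⟨x,x'⟩^m`);
* hence `Σ_{a,b} c_a c_b P^μ_j(2⟨x_a,x_b⟩, |x_a|²|x_b|²) = (a_j 2^j j!)⁻¹ B(Σ c_a h_a, Σ c_a h_a)`,
  which is `≥ 0`.

Points are plain coordinate vectors `Fin n → ℝ` (`⟨x, x'⟩ = Σ_k x_k x'_k`).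

## References

* G. E. Andrews, R. Askey, R. Roy, *Special Functions*, CUP 1999, §9.6 (zonal harmonics,
  Thm. 9.6.3). [AndrewsAskeyRoy1999]
* E. M. Stein, G. Weiss, *Introduction to Fourier Analysis on Euclidean Spaces*, Princeton
  1971, Ch. IV §2. [folklore]
-/

noncomputable section

namespace Literature.Analysis.SpecialFunctions

open Finset _root_.MvPolynomial Literature.RingTheory.MvPolynomial
open scoped Nat

variable {n : ℕ}

/-- The **zonal polynomial** `h_{j,x}(y) = P^μ_j(2 L_x(y), |x|² Q(y)) ∈ ℝ[y₁,…,yₙ]` (for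
`μ = (n-2)/2` a multiple of the zonal harmonic of degree `j` with pole `x`), expanded:
`h_{j,x} = Σ_{(i,m) ∈ AD j} a_m C(m,i) (-|x|²)^i 2^{m-i} · Q^i L_x^{m-i}`.
[cite: AndrewsAskeyRoy1999, §9.6 (zonal harmonics)] -/
theorem gegenbauerHom_zonal_eq_sum (μ : ℝ) (j : ℕ) (x : Fin n → ℝ) :
    gegenbauerHom μ j (C 2 * innerForm x) (C (∑ k, x k ^ 2) * sqNormPoly n) =
      ∑ y ∈ antidiagonal j, C (gegenbauerA μ y.2 * (y.2.choose y.1 : ℝ) *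
        (-(∑ k, x k ^ 2)) ^ y.1 * 2 ^ (y.2 - y.1)) *
        (sqNormPoly n ^ y.1 * innerForm x ^ (y.2 - y.1)) := by
  unfold gegenbauerHom
  refine Finset.sum_congr rfl fun y _ => ?_
  rw [smul_eq_C_mul, neg_mul_eq_neg_mul, mul_pow, mul_pow, ← map_neg, ← map_pow, ← map_pow]
  simp only [map_mul]
  ring

/-- `Δ` commutes with finite sums. [folklore] -/
theorem laplacian_finset_sum {ι : Type*} (s : Finset ι) (F : ι → MvPolynomial (Fin n) ℝ) :
    laplacian (∑ i ∈ s, F i) = ∑ i ∈ s, laplacian (F i) := by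
  unfold laplacian
  rw [Finset.sum_comm]
  simp [map_sum]

/-- **The zonal polynomial is harmonic** when `μ = (n-2)/2` (`n = 2μ + 2`): the classical
`Δ_y ‖y‖^j C^μ_j(⟨x,y⟩/‖y‖) = 0`, here by the explicit `Δ(Q^i L^m)` and the cancellation
`a_{m+1} C(m+1,i)(m-i+1)(m-i) = a_m C(m,i+1)(i+1)(m+μ)` along the antidiagonal.
[cite: AndrewsAskeyRoy1999, §9.6] -/
theorem laplacian_gegenbauerHom_zonal {μ : ℝ} (hμ : (n : ℝ) = 2 * μ + 2) (j : ℕ)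
    (x : Fin n → ℝ) :
    laplacian (gegenbauerHom μ j (C 2 * innerForm x) (C (∑ k, x k ^ 2) * sqNormPoly n)) = 0 := by
  set s : ℝ := ∑ k, x k ^ 2 with hs
  -- the two families of terms of `Δ h`
  set T₁ : ℕ × ℕ → MvPolynomial (Fin n) ℝ := fun y =>
    C (gegenbauerA μ y.2 * (y.2.choose y.1 : ℝ) * (-s) ^ y.1 * 2 ^ (y.2 - y.1) *
      (2 * y.1 * (2 * y.1 + 2 * (y.2 - y.1 : ℕ) + n - 2 : ℝ))) *
      (sqNormPoly n ^ (y.1 - 1) * innerForm x ^ (y.2 - y.1)) with hT₁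
  set T₂ : ℕ × ℕ → MvPolynomial (Fin n) ℝ := fun y =>
    C (gegenbauerA μ y.2 * (y.2.choose y.1 : ℝ) * (-s) ^ y.1 * 2 ^ (y.2 - y.1) *
      ((((y.2 - y.1) * (y.2 - y.1 - 1) : ℕ) : ℝ) * s)) *
      (sqNormPoly n ^ y.1 * innerForm x ^ (y.2 - y.1 - 2)) with hT₂
  have hΔ : laplacian (gegenbauerHom μ j (C 2 * innerForm x) (C (∑ k, x k ^ 2) * sqNormPoly n)) =
      ∑ y ∈ antidiagonal j, T₁ y + ∑ y ∈ antidiagonal j, T₂ y := by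
    rw [gegenbauerHom_zonal_eq_sum, laplacian_finset_sum, ← Finset.sum_add_distrib]
    refine Finset.sum_congr rfl fun y _ => ?_
    rw [laplacian_C_mul, laplacian_sqNormPoly_pow_mul_innerForm_pow, hT₁, hT₂]
    simp only [map_mul]
    push_cast
    ring
  rw [hΔ]
  rcases j with _ | j
  · simp [hT₁, hT₂]
  rw [Nat.sum_antidiagonal_succ, Nat.sum_antidiagonal_succ']
  have h10 : T₁ (0, j + 1) = 0 := by simp [hT₁]
  have h20 : T₂ (j + 1, 0) = 0 := by simp [hT₂]
  rw [h10, h20, zero_add, zero_add, ← Finset.sum_add_distrib]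
  refine Finset.sum_eq_zero fun y hy => ?_
  rw [mem_antidiagonal] at hy
  obtain ⟨i, m⟩ := y
  simp only at hy ⊢
  simp only [hT₁, hT₂, Nat.add_sub_cancel, show m + 1 - i - 2 = m - (i + 1) by omega]
  rw [← add_mul, ← map_add]
  by_cases him : i + 1 ≤ m
  · obtain ⟨d, rfl⟩ := Nat.exists_eq_add_of_le him
    have e1 := gegenbauerA_succ_mul μ (i + 1 + d)
    have r1 : (((i + 1 + d).choose (i + 1) : ℕ) : ℝ) * (i + 1) =
        (((i + 1 + d).choose i : ℕ) : ℝ) * (d + 1) := by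
      have := Nat.choose_succ_right_eq (i + 1 + d) i
      rw [show i + 1 + d - i = d + 1 by omega] at this
      exact_mod_cast this
    have r2 : (((i + 1 + d + 1).choose i : ℕ) : ℝ) * (d + 2) =
        (((i + 1 + d).choose i : ℕ) : ℝ) * (i + 1 + d + 1) := by
      have := Nat.choose_mul_succ_eq (i + 1 + d) i
      rw [show i + 1 + d + 1 - i = d + 2 by omega] at this
      exact_mod_cast this.symm
    apply mul_eq_zero_of_left
    rw [C_eq_zero]
    simp only [show i + 1 + d - (i + 1) = d by omega,
      show i + 1 + d + 1 - i = d + 2 by omega, show d + 2 - 1 = d + 1 by omega]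
    rw [hμ]
    push_cast
    push_cast at e1
    linear_combination ((-s) ^ i * s * 2 ^ d) *
      (-4 * ((i : ℝ) + d + 1 + μ) * gegenbauerA μ (i + 1 + d) * r1 +
        4 * ((d : ℝ) + 1) * gegenbauerA μ (i + 1 + d + 1) * r2 +
        4 * ((d : ℝ) + 1) * (((i + 1 + d).choose i : ℕ) : ℝ) * e1)
  · have hlt : m < i + 1 := not_le.1 him
    have hz1 : gegenbauerA μ m * ((m.choose (i + 1) : ℕ) : ℝ) * (-s) ^ (i + 1) *
        2 ^ (m - (i + 1)) = 0 := by
      simp [Nat.choose_eq_zero_of_lt hlt]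
    have hz2 : ((((m + 1 - i) * (m + 1 - i - 1) : ℕ) : ℝ)) = 0 := by
      have : m + 1 - i ≤ 1 := by omega
      interval_cases h : (m + 1 - i) <;> simp
    simp only [hz1, zero_mul, zero_add]
    rw [hz2]
    simp

/-- `B(f, 0) = 0`. [folklore] -/
theorem fischer_zero_right (f : MvPolynomial (Fin n) ℝ) : fischer f 0 = 0 := by
  simp [fischer]

/-- **The Gram identity**: `B(h_{j,x}, h_{j,x'}) = a_j 2^j j! · P^μ_j(2⟨x',x⟩, |x'|²|x|²)` (the
reproducing property of the zonal harmonic for the Fischer pairing). [folklore] -/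
theorem fischer_gegenbauerHom_zonal {μ : ℝ} (hμ : (n : ℝ) = 2 * μ + 2) (j : ℕ)
    (x x' : Fin n → ℝ) :
    fischer (gegenbauerHom μ j (C 2 * innerForm x) (C (∑ k, x k ^ 2) * sqNormPoly n))
      (gegenbauerHom μ j (C 2 * innerForm x') (C (∑ k, x' k ^ 2) * sqNormPoly n)) =
      gegenbauerA μ j * 2 ^ j * j ! *
        gegenbauerHom μ j (2 * ∑ k, x' k * x k) ((∑ k, x' k ^ 2) * ∑ k, x k ^ 2) := by
  -- Step 1: only the `i = 0` term of `h_x` survives, by harmonicity of `h_{x'}`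
  set h' := gegenbauerHom μ j (C 2 * innerForm x') (C (∑ k, x' k ^ 2) * sqNormPoly n) with hh'
  have h1 : fischer (gegenbauerHom μ j (C 2 * innerForm x) (C (∑ k, x k ^ 2) * sqNormPoly n)) h' =
      gegenbauerA μ j * 2 ^ j * fischer (innerForm x ^ j) h' := by
    rw [gegenbauerHom_zonal_eq_sum μ j x, fischer_sum_left, Finset.sum_eq_single (0, j)]
    · dsimp only
      have h0 : gegenbauerA μ j * ((j.choose 0 : ℕ) : ℝ) * (-(∑ k, x k ^ 2)) ^ 0 * 2 ^ (j - 0) =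
          gegenbauerA μ j * 2 ^ j := by simp
      rw [h0, pow_zero, one_mul, Nat.sub_zero, fischer_C_mul_left]
    · intro y hy hne
      rw [mem_antidiagonal] at hy
      obtain ⟨i, m⟩ := y
      rcases i with _ | i
      · exact absurd (by simpa using hy) hne
      · rw [fischer_C_mul_left, fischer_sqNormPoly_pow_mul, Function.iterate_succ_apply,
          hh', laplacian_gegenbauerHom_zonal hμ, iterate_laplacian_zero, fischer_zero_right,
          mul_zero]
    · intro h
      exact absurd (by simp) h
  -- Step 2: `B(L_x^j, h_{x'})` termwise
  have h2 : fischer (innerForm x ^ j) h' =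
      j ! * gegenbauerHom μ j (2 * ∑ k, x' k * x k) ((∑ k, x' k ^ 2) * ∑ k, x k ^ 2) := by
    rw [hh', gegenbauerHom_zonal_eq_sum μ j x', fischer_sum_right, gegenbauerHom, Finset.mul_sum]
    refine Finset.sum_congr rfl fun y hy => ?_
    rw [mem_antidiagonal] at hy
    obtain ⟨i, m⟩ := y
    simp only at hy ⊢
    rw [fischer_C_mul_right, fischer_comm, fischer_sqNormPoly_pow_mul]
    by_cases him : i ≤ m
    · obtain ⟨d, rfl⟩ := Nat.exists_eq_add_of_le him
      rw [Nat.add_sub_cancel_left, show j = d + 2 * i by omega, iterate_laplacian_innerForm_pow,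
        fischer_C_mul_right, fischer_innerForm_pow]
      simp only [smul_eq_mul]
      have hd : (d ! : ℝ) ≠ 0 := by exact_mod_cast Nat.factorial_ne_zero d
      field_simp
      ring
    · have hlt : m < i := not_le.1 him
      simp [Nat.choose_eq_zero_of_lt hlt]
  rw [h1, h2]
  ring

/-- **Positivity of the zonal Gegenbauer kernel** (`μ = (n-2)/2 > 0`, i.e. `n ≥ 3`): for any
finitely many points `x_a ∈ ℝⁿ` and real coefficients `c_a`,
`Σ_{a,b} c_a c_b P^μ_j(2⟨x_a, x_b⟩, |x_a|²|x_b|²) ≥ 0` — the kernel is a Gram kernel for the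
Fischer pairing (equivalently: the addition theorem, AAR Thm. 9.6.3).
[cite: AndrewsAskeyRoy1999, Thm. 9.6.3] -/
theorem sum_mul_gegenbauerHom_nonneg {μ : ℝ} (hμ : (n : ℝ) = 2 * μ + 2) (hμpos : 0 < μ)
    (j : ℕ) {ι : Type*} [Fintype ι] (x : ι → Fin n → ℝ) (c : ι → ℝ) :
    0 ≤ ∑ a, ∑ b, c a * c b *
      gegenbauerHom μ j (2 * ∑ k, x a k * x b k) ((∑ k, x a k ^ 2) * ∑ k, x b k ^ 2) := by
  set K : ℝ := gegenbauerA μ j * 2 ^ j * j ! with hK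
  have hKpos : 0 < K := by
    have := gegenbauerA_pos hμpos j
    positivity
  set H : ι → MvPolynomial (Fin n) ℝ := fun a =>
    gegenbauerHom μ j (C 2 * innerForm (x a)) (C (∑ k, x a k ^ 2) * sqNormPoly n) with hH
  have key : ∀ a b, gegenbauerHom μ j (2 * ∑ k, x a k * x b k) ((∑ k, x a k ^ 2) * ∑ k, x b k ^ 2)
      = K⁻¹ * fischer (H b) (H a) := by
    intro a b
    rw [hH, fischer_gegenbauerHom_zonal hμ, ← hK, ← mul_assoc, inv_mul_cancel₀ hKpos.ne',
      one_mul]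
  simp_rw [key]
  have hsum : ∑ a, ∑ b, c a * c b * (K⁻¹ * fischer (H b) (H a)) =
      K⁻¹ * fischer (∑ b, c b • H b) (∑ a, c a • H a) := by
    rw [fischer_sum_left, Finset.mul_sum, Finset.sum_comm]
    refine Finset.sum_congr rfl fun b _ => ?_
    rw [fischer_smul_left, fischer_sum_right, Finset.mul_sum, Finset.mul_sum]
    refine Finset.sum_congr rfl fun a _ => ?_
    rw [fischer_smul_right]
    ring
  rw [hsum]
  exact mul_nonneg (inv_nonneg.2 hKpos.le) (fischer_self_nonneg _)

end Literature.Analysis.SpecialFunctions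

end
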